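import Mathlib
import Literature.Computability.AlgebraicComplexity.BirkhoffShadow
import Literature.Computability.AlgebraicComplexity.BirkhoffShadowProofs
import Literature.Computability.AlgebraicComplexity.BirkhoffShadowLowerBound
import Summits.ValiantsHypothesis.ValiantsHypothesis.Theorems.DivisionGapShadowBirkhoffPolytropeDefs

/-!
# `DivisionGap.ShadowBirkhoff` (stmt-ValiantsHypothesis-5069), line `polytrope-kr-planar-dimers` —
# stub `stub_faceShadow`

The planar shadow of a pattern face of the Birkhoff polytope is seen, up to the factor `4`, by a
shadow of the whole Birkhoff polytope: for every pattern `Z ⊆ [n]²` and every linear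
`L : ℝ^{n×n} → ℝ²` there is a linear `L'` with `|vert conv L(F_Z)| ≤ 4 · |vert conv L'(DS_n)|`,
where `F_Z = patternPoints n Z` is the set of permutation matrices supported in `Z` (entry
`(i, j) = 1` iff `ρ j = i`) and `|vert conv L'(DS_n)| = birkhoffShadowVertexCount L'`.

Proof.  `S = L(F_Z)` is finite, and every extreme point of `conv S` is the unique maximiser over
`S` of a functional from one of the four pencils `±x₀ + t·x₁`, `±x₁ + t·x₀`
(`HrubesYehudayoff2021Prop23.extremePoints_subset_um4`).  Fix a pencil `c + t·d` together with a
vector `e` with `c e = 1`, `d e = 0`, and penalise the off-pattern mass: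
`L' = L − M·φ_Z(·)·e` with `φ_Z(X) = Σ_{ij ∉ Z} X ij` (zero on `F_Z`, at least `1` on every other
permutation matrix) and a penalty `M ≥ 0` exceeding the finitely many pencil defects.  A point
`p ∈ S` that is the unique maximiser of `c + t·d` over `S` is then the unique maximiser of the same
(continuous linear) functional over `L'(vert DS_n)` — pattern matrices give the points of `S`, the
other permutation matrices are pushed below `p` by the penalty — hence an extreme point of the
shadow `conv L'(vert DS_n)` (`BirkhoffShadowLower.mem_extremePoints_convexHull_of_forall_lt`).
So each of the four sets of uniquely supported points has at most `birkhoffShadowVertexCount L'ₖ`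
elements for a suitable `L'ₖ`, and the `L'ₖ` with the largest count bounds the number of extreme
points of `conv S` by `4 · birkhoffShadowVertexCount L'`.
-/

set_option linter.dupNamespace false

noncomputable section

open scoped BigOperators

namespace Summit.ValiantsHypothesis.ValiantsHypothesis.Theorems.DivisionGapShadowBirkhoff

open Literature.Computability.AlgebraicComplexity

/-- `UM[c, d, X]`: the points `p ∈ X` that are the unique maximiser over `X` of `c + t • d` for
some real `t` (notation local to this file, literally the one of
`Literature/Computability/AlgebraicComplexity/BirkhoffShadowProofs.lean`). -/
local notation3 (prettyPrint := false) "UM[" c ", " d ", " X "]" =>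
  {p | p ∈ X ∧ ∃ t : ℝ, ∀ q ∈ X, q ≠ p → c q + t * d q < c p + t * d p}

/-- A real-valued function on a finite type is strictly bounded above by a nonnegative real
(`1 + Σ |f|`). [folklore] -/
theorem faceShadow_exists_nonneg_forall_lt {ι : Type*} [Finite ι] (f : ι → ℝ) :
    ∃ P : ℝ, 0 ≤ P ∧ ∀ i, f i < P := by
  cases nonempty_fintype ι
  refine ⟨1 + ∑ i, |f i|, by positivity, fun i => ?_⟩
  have h1 : f i ≤ |f i| := le_abs_self _
  have h2 : |f i| ≤ ∑ j, |f j| :=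
    Finset.single_le_sum (fun j _ => abs_nonneg (f j)) (Finset.mem_univ i)
  linarith

/-- The pattern permutation matrices are permutation matrices. [folklore] -/
theorem patternPoints_subset_permMatrixPoints (n : ℕ) (Z : Set (Fin n × Fin n)) :
    patternPoints n Z ⊆ permMatrixPoints n := by
  rintro x ⟨ρ, -, rfl⟩
  exact ⟨ρ, rfl⟩

/-- There are finitely many permutation matrices. [folklore] -/
theorem faceShadow_permMatrixPoints_finite (n : ℕ) : (permMatrixPoints n).Finite :=
  (Set.finite_range fun (ρ : Equiv.Perm (Fin n)) (ij : Fin n × Fin n) =>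
      if ρ ij.2 = ij.1 then (1 : ℝ) else 0).subset fun x hx => by
    obtain ⟨ρ, rfl⟩ := hx
    exact ⟨ρ, rfl⟩

/-- **One pencil.**  For a pencil `c + t·d` of (homogeneous, additive) functionals on `ℝ²` and a
vector `e` with `c e = 1`, `d e = 0`, the points of `S = L(F_Z)` uniquely supported over `S` by
the pencil are at most `birkhoffShadowVertexCount L'` in number, for the penalised map
`L' = L − M·φ_Z(·)·e`. [folklore] -/
theorem faceShadow_pencil {n : ℕ} (Z : Set (Fin n × Fin n))
    (L : (Fin n × Fin n → ℝ) →ₗ[ℝ] (Fin 2 → ℝ)) (c d : (Fin 2 → ℝ) →+ ℝ)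
    (hc : ∀ (r : ℝ) (y : Fin 2 → ℝ), c (r • y) = r * c y)
    (hd : ∀ (r : ℝ) (y : Fin 2 → ℝ), d (r • y) = r * d y)
    (e : Fin 2 → ℝ) (hce : c e = 1) (hde : d e = 0) :
    ∃ L' : (Fin n × Fin n → ℝ) →ₗ[ℝ] (Fin 2 → ℝ),
      (UM[c, d, L '' patternPoints n Z]).ncard ≤ birkhoffShadowVertexCount L' := by
  classical
  -- finiteness of the projected (pattern) permutation matrices
  have hTfin : (L '' permMatrixPoints n).Finite := (faceShadow_permMatrixPoints_finite n).image _
  have hSfin : (L '' patternPoints n Z).Finite :=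
    ((faceShadow_permMatrixPoints_finite n).subset
      (patternPoints_subset_permMatrixPoints n Z)).image _
  -- the off-pattern mass `φ_Z(X) = Σ_{ij ∉ Z} X ij`
  obtain ⟨φ, hφ⟩ : ∃ φ : (Fin n × Fin n → ℝ) →ₗ[ℝ] ℝ,
      ∀ X, φ X = ∑ ij, if ij ∈ Z then (0 : ℝ) else X ij :=
    ⟨{ toFun := fun X => ∑ ij, if ij ∈ Z then (0 : ℝ) else X ij
       map_add' := fun X Y => by
         rw [← Finset.sum_add_distrib]
         refine Finset.sum_congr rfl fun ij _ => ?_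
         split_ifs <;> simp
       map_smul' := fun r X => by
         simp only [RingHom.id_apply, smul_eq_mul, Finset.mul_sum, Pi.smul_apply]
         refine Finset.sum_congr rfl fun ij _ => ?_
         split_ifs <;> simp }, fun _ => rfl⟩
  -- `φ_Z` vanishes on the pattern matrices ...
  have hφ0 : ∀ x ∈ patternPoints n Z, φ x = 0 := by
    rintro x ⟨ρ, hρ, rfl⟩
    rw [hφ]
    refine Finset.sum_eq_zero ?_
    rintro ⟨i, j⟩ -
    dsimp only
    by_cases hij : (i, j) ∈ Z
    · rw [if_pos hij]
    · by_cases h : ρ j = i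
      · subst h
        exact absurd (hρ j) hij
      · rw [if_neg hij, if_neg h]
  -- ... and is at least `1` on every other permutation matrix
  have hφ1 : ∀ x ∈ permMatrixPoints n, x ∉ patternPoints n Z → 1 ≤ φ x := by
    rintro x ⟨ρ, rfl⟩ hx
    have hρ : ¬ ∀ j, (ρ j, j) ∈ Z := fun h => hx ⟨ρ, h, rfl⟩
    obtain ⟨j₀, hj₀⟩ := not_forall.mp hρ
    rw [hφ]
    calc (1 : ℝ) = (if (ρ j₀, j₀) ∈ Z then (0 : ℝ) else
          if ρ (ρ j₀, j₀).2 = (ρ j₀, j₀).1 then 1 else 0) := by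
          rw [if_neg hj₀, if_pos rfl]
      _ ≤ ∑ ij : Fin n × Fin n, (if ij ∈ Z then (0 : ℝ) else
            if ρ ij.2 = ij.1 then 1 else 0) :=
          Finset.single_le_sum (f := fun ij : Fin n × Fin n =>
              if ij ∈ Z then (0 : ℝ) else if ρ ij.2 = ij.1 then 1 else 0)
            (fun ij _ => by split_ifs <;> norm_num) (Finset.mem_univ _)
  -- a witness parameter `t` for every uniquely supported point
  obtain ⟨tw, htw⟩ : ∃ tw : (Fin 2 → ℝ) → ℝ, ∀ p : Fin 2 → ℝ,
      (∃ t : ℝ, ∀ q ∈ L '' patternPoints n Z, q ≠ p → c q + t * d q < c p + t * d p) →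
        ∀ q ∈ L '' patternPoints n Z, q ≠ p → c q + tw p * d q < c p + tw p * d p := by
    refine ⟨fun p => if h : ∃ t : ℝ, ∀ q ∈ L '' patternPoints n Z, q ≠ p →
        c q + t * d q < c p + t * d p then Classical.choose h else 0, fun p hp => ?_⟩
    dsimp only
    rw [dif_pos hp]
    exact Classical.choose_spec hp
  -- the penalty, exceeding the finitely many pencil defects
  haveI := hTfin.to_subtype
  haveI := hSfin.to_subtype
  obtain ⟨M, hM0, hM⟩ := faceShadow_exists_nonneg_forall_lt
    (fun yp : ↥(L '' permMatrixPoints n) × ↥(L '' patternPoints n Z) =>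
      c (yp.1 : Fin 2 → ℝ) + tw yp.2 * d (yp.1 : Fin 2 → ℝ) -
        (c (yp.2 : Fin 2 → ℝ) + tw yp.2 * d (yp.2 : Fin 2 → ℝ)))
  -- the penalised linear map
  set L' : (Fin n × Fin n → ℝ) →ₗ[ℝ] (Fin 2 → ℝ) := L - LinearMap.smulRight φ (M • e) with hL'
  have hL'apply : ∀ X, L' X = L X - φ X • (M • e) := fun X => by
    simp only [hL', LinearMap.sub_apply, LinearMap.smulRight_apply]
  have hcL' : ∀ X, c (L' X) = c (L X) - φ X * M := fun X => by
    rw [hL'apply, map_sub, hc, hc, hce, mul_one]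
  have hdL' : ∀ X, d (L' X) = d (L X) := fun X => by
    rw [hL'apply, map_sub, hd, hd, hde, mul_zero, mul_zero, sub_zero]
  have hL'pat : ∀ x ∈ patternPoints n Z, L' x = L x := fun x hx => by
    rw [hL'apply, hφ0 x hx, zero_smul, sub_zero]
  -- the extreme points of the penalised shadow form a finite set
  have hE'fin : ((convexHull ℝ (L' '' permMatrixPoints n)).extremePoints ℝ).Finite :=
    ((faceShadow_permMatrixPoints_finite n).image _).subset extremePoints_convexHull_subset
  refine ⟨L', Set.ncard_le_ncard ?_ hE'fin⟩
  -- every uniquely supported point of `S` is an extreme point of the penalised shadow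
  rintro p ⟨hpS, hpt⟩
  have ht := htw p hpt
  obtain ⟨xσ, hxσ, rfl⟩ := hpS
  -- the supporting functional `y ↦ c y + t · d y`
  let l : (Fin 2 → ℝ) →L[ℝ] ℝ := LinearMap.toContinuousLinearMap
    { toFun := fun y => c y + tw (L xσ) * d y
      map_add' := fun y y' => by
        simp only [map_add]
        ring
      map_smul' := fun r y => by
        simp only [hc, hd, smul_eq_mul, RingHom.id_apply]
        ring }
  have hl : ∀ y, l y = c y + tw (L xσ) * d y := fun y => rfl
  apply BirkhoffShadowLower.mem_extremePoints_convexHull_of_forall_lt l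
  · exact ⟨xσ, patternPoints_subset_permMatrixPoints n Z hxσ, hL'pat xσ hxσ⟩
  · rintro s ⟨x, hx, rfl⟩ hne
    rw [hl, hl, hcL', hdL']
    by_cases hxp : x ∈ patternPoints n Z
    · -- a pattern matrix: a point of `S`, below `p` by unique support
      rw [hφ0 x hxp, zero_mul, sub_zero]
      have hne' : L x ≠ L xσ := by rwa [hL'pat x hxp] at hne
      exact ht (L x) ⟨x, hxp, rfl⟩ hne'
    · -- an off-pattern matrix: pushed below `p` by the penalty
      have h1 : 1 ≤ φ x := hφ1 x hx hxp
      have h2 : c (L x) + tw (L xσ) * d (L x) - (c (L xσ) + tw (L xσ) * d (L xσ)) < M :=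
        hM (⟨L x, x, hx, rfl⟩, ⟨L xσ, xσ, hxσ, rfl⟩)
      have h3 : 1 * M ≤ φ x * M := mul_le_mul_of_nonneg_right h1 hM0
      linarith

/-- **Pattern faces are seen by Birkhoff shadows, up to the factor `4`.**  For every pattern
`Z ⊆ [n]²` and linear `L : ℝ^{n×n} → ℝ²` there is a linear `L'` with
`|vert conv L(F_Z)| ≤ 4 · |vert conv L'(DS_n)|`: the extreme points of `conv L(F_Z)` are uniquely
supported by one of four pencils (`HrubesYehudayoff2021Prop23.extremePoints_subset_um4`), each
pencil is handled by `faceShadow_pencil`, and the penalised map with the largest shadow vertex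
count dominates all four terms. [folklore] -/
theorem stub_faceShadow : ∀ (n : ℕ) (Z : Set (Fin n × Fin n))
    (L : (Fin n × Fin n → ℝ) →ₗ[ℝ] (Fin 2 → ℝ)),
    ∃ L' : (Fin n × Fin n → ℝ) →ₗ[ℝ] (Fin 2 → ℝ),
      patternShadowVertexCount Z L ≤ 4 * birkhoffShadowVertexCount L' := by
  intro n Z L
  -- the two coordinate functionals
  obtain ⟨c₀, hc₀⟩ : ∃ c₀ : (Fin 2 → ℝ) →+ ℝ, ∀ y, c₀ y = y 0 :=
    ⟨Pi.evalAddMonoidHom (fun _ : Fin 2 => ℝ) 0, fun _ => rfl⟩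
  obtain ⟨c₁, hc₁⟩ : ∃ c₁ : (Fin 2 → ℝ) →+ ℝ, ∀ y, c₁ y = y 1 :=
    ⟨Pi.evalAddMonoidHom (fun _ : Fin 2 => ℝ) 1, fun _ => rfl⟩
  have h0 : ∀ (r : ℝ) (y : Fin 2 → ℝ), c₀ (r • y) = r * c₀ y := fun r y => by
    rw [hc₀, hc₀, Pi.smul_apply, smul_eq_mul]
  have h1 : ∀ (r : ℝ) (y : Fin 2 → ℝ), c₁ (r • y) = r * c₁ y := fun r y => by
    rw [hc₁, hc₁, Pi.smul_apply, smul_eq_mul]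
  have h0' : ∀ (r : ℝ) (y : Fin 2 → ℝ), (-c₀) (r • y) = r * (-c₀) y := fun r y => by
    rw [AddMonoidHom.neg_apply, AddMonoidHom.neg_apply, h0, mul_neg]
  have h1' : ∀ (r : ℝ) (y : Fin 2 → ℝ), (-c₁) (r • y) = r * (-c₁) y := fun r y => by
    rw [AddMonoidHom.neg_apply, AddMonoidHom.neg_apply, h1, mul_neg]
  -- one penalised map per pencil
  obtain ⟨L₁, hL₁⟩ := faceShadow_pencil Z L c₀ c₁ h0 h1 (Pi.single 0 1)
    (by rw [hc₀]; simp) (by rw [hc₁]; simp)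
  obtain ⟨L₂, hL₂⟩ := faceShadow_pencil Z L (-c₀) c₁ h0' h1 (Pi.single 0 (-1))
    (by rw [AddMonoidHom.neg_apply, hc₀]; simp) (by rw [hc₁]; simp)
  obtain ⟨L₃, hL₃⟩ := faceShadow_pencil Z L c₁ c₀ h1 h0 (Pi.single 1 1)
    (by rw [hc₁]; simp) (by rw [hc₀]; simp)
  obtain ⟨L₄, hL₄⟩ := faceShadow_pencil Z L (-c₁) c₀ h1' h0 (Pi.single 1 (-1))
    (by rw [AddMonoidHom.neg_apply, hc₁]; simp) (by rw [hc₀]; simp)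
  -- a penalised map dominating all four counts
  have hmax : ∀ A B : (Fin n × Fin n → ℝ) →ₗ[ℝ] (Fin 2 → ℝ),
      ∃ C : (Fin n × Fin n → ℝ) →ₗ[ℝ] (Fin 2 → ℝ),
        birkhoffShadowVertexCount A ≤ birkhoffShadowVertexCount C ∧
          birkhoffShadowVertexCount B ≤ birkhoffShadowVertexCount C := by
    intro A B
    rcases le_total (birkhoffShadowVertexCount A) (birkhoffShadowVertexCount B) with h | h
    · exact ⟨B, h, le_rfl⟩
    · exact ⟨A, le_rfl, h⟩
  obtain ⟨L₁₂, h12a, h12b⟩ := hmax L₁ L₂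
  obtain ⟨L₃₄, h34a, h34b⟩ := hmax L₃ L₄
  obtain ⟨L', ha, hb⟩ := hmax L₁₂ L₃₄
  refine ⟨L', ?_⟩
  set S : Set (Fin 2 → ℝ) := L '' patternPoints n Z with hS
  have hSfin : S.Finite :=
    ((faceShadow_permMatrixPoints_finite n).subset
      (patternPoints_subset_permMatrixPoints n Z)).image _
  -- the extreme points of `conv S` are uniquely supported by one of the four pencils
  have hsub := HrubesYehudayoff2021Prop23.extremePoints_subset_um4 c₀ c₁ hc₀ hc₁ S hSfin
  have hf : ∀ c d : (Fin 2 → ℝ) →+ ℝ, (UM[c, d, S]).Finite := fun c d =>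
    hSfin.subset fun p hp => hp.1
  have hE : ((convexHull ℝ S).extremePoints ℝ).ncard ≤
      (UM[c₀, c₁, S]).ncard + (UM[(-c₀), c₁, S]).ncard + (UM[c₁, c₀, S]).ncard +
        (UM[(-c₁), c₀, S]).ncard :=
    (Set.ncard_le_ncard hsub ((((hf _ _).union (hf _ _)).union (hf _ _)).union (hf _ _))).trans
      ((Set.ncard_union_le _ _).trans (add_le_add ((Set.ncard_union_le _ _).trans
        (add_le_add (Set.ncard_union_le _ _) le_rfl)) le_rfl))
  show ((convexHull ℝ S).extremePoints ℝ).ncard ≤ 4 * birkhoffShadowVertexCount L'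
  omega

end Summit.ValiantsHypothesis.ValiantsHypothesis.Theorems.DivisionGapShadowBirkhoff

end
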